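import Summits.NavierStokesRegularity.FunctionalMining.TrigPolyExact
import Literature.Analysis.FunctionSpaces.TorusEnstrophyOrthogonality
import Literature.Analysis.FunctionSpaces.TorusFourierConvolution
import HarnessLib

/-!
# FunctionalMining — exact trigonometric-polynomial calculus on `T³` (engine, part 2: `∂`, `Δ`, `Δ⁻¹`, `∫`)

Search for candidate a priori estimates; no regularity claim. Cell `pub-nsfunc`, prove seat
(gen 18). TOOL FILE (no statement about Navier–Stokes).

For the finite Fourier tables `TP` of part 1 (`TrigPolyExact`): the computable operations
* `TP.D j` (coefficient `c ↦ c · i kⱼ`) with `partialDeriv j (eval p) = 2π · eval (D j p)` and the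
  real form `partialDeriv_evalR`;
* `TP.lapT` (`= ∑ⱼ D j (D j ·)`) with `laplacian (evalR p) = (2π)² · evalR (lapT p)`;
* `TP.coeff0` (sum of the zero-mode coefficients) with `∫ eval p = coeff0 p` and `∫ evalR p = (coeff0 p).re`;
* `TP.linv` (coefficient `c ↦ −c/|k|²`) with, for tables WITHOUT zero mode (`NoZeroMode`, decidable),
  `invLaplacian (evalR p) = (2π)⁻² · evalR (linv p)` (`invLaplacian_evalR`, via the tree's uniqueness
  `invLaplacian_laplacian_of_integral_eq_zero`);
* `TP.symm` — a real pair `c e_k + c̄ e_{−k}` (`IsReal`), the building block of real input tables.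
-/

noncomputable section

open MeasureTheory Complex UnitAddTorus

namespace Summit.NavierStokesRegularity.FunctionalMining

open Literature.Analysis.FunctionSpaces Literature.Analysis.FunctionSpaces.Torus

namespace TrigPolyExact

namespace GQ

/-- Complex conjugate. [ours; bookkeeping] -/
protected def conj (a : GQ) : GQ := ⟨a.re, -a.im⟩

/-- `toC` commutes with conjugation. [ours; bookkeeping] -/
@[simp] theorem toC_conj (a : GQ) : a.conj.toC = starRingEnd ℂ a.toC := by
  apply Complex.ext <;> simp [GQ.conj, toC]

end GQ

/-- `vec (−k) = −vec k`. [ours; bookkeeping] -/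
theorem Mode.vec_neg (k : Mode) : (-k).vec = -k.vec := by
  ext i; fin_cases i <;> rfl

namespace TP

variable (x : UnitAddTorus (Fin 3))

/-! ## 1. Partial derivatives -/

/-- `∂ⱼ / (2π)` on tables: the coefficient of `e_k` is multiplied by `i kⱼ`. [ours; bookkeeping] -/
def D (j : Fin 3) (p : TP) : TP := p.map fun t => (t.1, GQ.smul (t.1.vec j : ℚ) (GQ.I.mul t.2))

/-- `∂ⱼ (c · e_m) = 2π · (c · i mⱼ) · e_m`. [folklore] -/
theorem partialDeriv_const_mul_mFourier (c : ℂ) (m : Fin 3 → ℤ) (j : Fin 3) (x : UnitAddTorus (Fin 3)) :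
    Torus.partialDeriv j (fun y : UnitAddTorus (Fin 3) => c * mFourier m y) x =
      2 * Real.pi * (c * (Complex.I * (m j))) * mFourier m x := by
  have h := ((isSmooth_mFourier m).hasDerivAt_line_zero j x).const_mul c
  rw [partialDeriv_mFourier] at h
  rw [Torus.partialDeriv, Torus.lineDeriv, h.deriv]
  ring

/-- **`∂ⱼ eval p = 2π · eval (D j p)`.** [ours; bookkeeping] -/
theorem partialDeriv_eval (j : Fin 3) (p : TP) (x : UnitAddTorus (Fin 3)) :
    Torus.partialDeriv j (eval p) x = 2 * Real.pi * eval (D j p) x := by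
  induction p with
  | nil =>
    simp only [D, List.map_nil, eval_nil, mul_zero]
    show Torus.partialDeriv j (fun _ => (0 : ℂ)) x = 0
    simp [Torus.partialDeriv, Torus.lineDeriv]
  | cons t p ih =>
    have hsplit : eval (t :: p) = (fun y => t.2.toC * mFourier t.1.vec y) + eval p := by
      funext y; simp [eval_cons]
    have h1 : IsSmooth (fun y : UnitAddTorus (Fin 3) => t.2.toC * mFourier t.1.vec y) := by
      simpa [smul_eq_mul, mul_comm] using isSmooth_mFourier_smul (d := Fin 3) t.1.vec t.2.toC
    rw [hsplit, partialDeriv_add (h1.isContDiff (by simp)) ((isSmooth_eval p).isContDiff (by simp)),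
      Pi.add_apply, ih, partialDeriv_const_mul_mFourier]
    simp only [D, List.map_cons, eval_cons, GQ.toC_smul, GQ.toC_mul, GQ.toC_I]
    push_cast
    ring

/-- Real form: **`∂ⱼ evalR p = 2π · evalR (D j p)`.** [ours; bookkeeping] -/
theorem partialDeriv_evalR (j : Fin 3) (p : TP) (x : UnitAddTorus (Fin 3)) :
    Torus.partialDeriv j (evalR p) x = 2 * Real.pi * evalR (D j p) x := by
  have h : evalR p = Complex.reCLM ∘ eval p := rfl
  rw [h, partialDeriv_clm_comp (isSmooth_eval p), partialDeriv_eval]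
  simp [evalR, Complex.mul_re]

/-- Function form of `partialDeriv_evalR`. [ours; bookkeeping] -/
theorem partialDeriv_evalR' (j : Fin 3) (p : TP) :
    Torus.partialDeriv j (evalR p) = fun x => 2 * Real.pi * evalR (D j p) x :=
  funext (partialDeriv_evalR j p)

/-- `D` preserves reality. [ours; bookkeeping] -/
theorem IsReal.D {p : TP} (hp : IsReal p) (j : Fin 3) : IsReal (TP.D j p) := by
  intro x
  have h := partialDeriv_eval j p x
  -- `∂ⱼ eval p` is the derivative of a real-valued function, hence real
  have hre : (Torus.partialDeriv j (eval p) x).im = 0 := by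
    have h2 : eval p = fun y => ((evalR p y : ℝ) : ℂ) := funext fun y => hp.eval_eq y
    rw [h2]
    have h3 : (fun y => ((evalR p y : ℝ) : ℂ)) = Complex.ofRealCLM ∘ evalR p := rfl
    rw [h3, partialDeriv_clm_comp (isSmooth_evalR p)]
    simp
  rw [h] at hre
  have hpi : (2 * Real.pi : ℝ) ≠ 0 := by positivity
  have : (2 * (Real.pi : ℂ) * eval (TP.D j p) x).im = 2 * Real.pi * (eval (TP.D j p) x).im := by
    simp [Complex.mul_im]
  rw [this] at hre
  exact (mul_eq_zero.mp hre).resolve_left hpi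

/-! ## 2. Laplacian -/

/-- `Δ / (2π)²` on tables. [ours; bookkeeping] -/
def lapT (p : TP) : TP := D 0 (D 0 p) ++ D 1 (D 1 p) ++ D 2 (D 2 p)

/-- **`Δ evalR p = (2π)² · evalR (lapT p)`.** [ours; bookkeeping] -/
theorem laplacian_evalR (p : TP) (x : UnitAddTorus (Fin 3)) :
    Torus.laplacian (evalR p) x = (2 * Real.pi) ^ 2 * evalR (lapT p) x := by
  rw [laplacian_eq_sum_partialDeriv_partialDeriv (isSmooth_evalR p), Fin.sum_univ_three]
  simp only [partialDeriv_evalR', lapT, evalR_append]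
  have hc : ∀ (j : Fin 3) (q : TP), Torus.partialDeriv j (fun y => 2 * Real.pi * evalR q y) x =
      2 * Real.pi * (2 * Real.pi * evalR (D j q) x) := by
    intro j q
    have : (fun y => 2 * Real.pi * evalR q y) = (2 * Real.pi) • evalR q := by funext y; simp
    rw [this, partialDeriv_const_smul ((isSmooth_evalR q).isContDiff (by simp)), Pi.smul_apply,
      smul_eq_mul, partialDeriv_evalR]
  rw [hc, hc, hc]
  ring

/-- `lapT` preserves reality. [ours; bookkeeping] -/
theorem IsReal.lapT {p : TP} (hp : IsReal p) : IsReal (TP.lapT p) :=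
  (((hp.D 0).D 0).append ((hp.D 1).D 1)).append ((hp.D 2).D 2)

/-! ## 3. Integral = zero Fourier mode -/

/-- Sum of the coefficients of the zero mode. [ours; bookkeeping] -/
def coeff0 : TP → GQ
  | [] => GQ.zero
  | t :: p => if t.1 = 0 then t.2.add (coeff0 p) else coeff0 p

/-- **`∫ eval p = coeff0 p`.** [ours; bookkeeping] -/
theorem integral_eval (p : TP) : ∫ x, eval p x = (coeff0 p).toC := by
  induction p with
  | nil => simp [coeff0]
  | cons t p ih =>
    have hsplit : eval (t :: p) = fun y => t.2.toC * mFourier t.1.vec y + eval p y := by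
      funext y; exact eval_cons t p y
    have hi1 : Integrable (fun y : UnitAddTorus (Fin 3) => t.2.toC * mFourier t.1.vec y) :=
      (continuous_const.mul (mFourier t.1.vec).continuous).integrable_unitAddTorus
    have hi2 : Integrable (eval p) := (isSmooth_eval p).continuous.integrable_unitAddTorus
    rw [hsplit, integral_add hi1 hi2, ih, integral_const_mul, integral_mFourier]
    by_cases h : t.1 = 0
    · have hv : t.1.vec = 0 := (Mode.vec_eq_zero_iff t.1).mpr h
      rw [if_pos hv]
      simp [coeff0, h]
    · have hv : t.1.vec ≠ 0 := fun h' => h ((Mode.vec_eq_zero_iff t.1).mp h')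
      rw [if_neg hv]
      simp [coeff0, h]

/-- **`∫ evalR p = (coeff0 p).re`.** [ours; bookkeeping] -/
theorem integral_evalR (p : TP) : ∫ x, evalR p x = (coeff0 p).re := by
  have hi : Integrable (eval p) := (isSmooth_eval p).continuous.integrable_unitAddTorus
  have h := integral_re hi
  simp only [RCLike.re_to_complex] at h
  simp only [evalR]
  rw [h, integral_eval, GQ.toC_re]

/-! ## 4. Inverse Laplacian -/

/-- `(2π)² Δ⁻¹` on tables: coefficient `c ↦ −c / |k|²` (zero modes are sent to `0`). [ours; bookkeeping] -/
def linv (p : TP) : TP := p.map fun t => (t.1, GQ.smul (-(1 / t.1.normSq)) t.2)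

/-- No zero mode occurs in the table (decidable). [ours; bookkeeping] -/
def NoZeroMode (p : TP) : Prop := ∀ t ∈ p, t.1 ≠ 0

/-- `NoZeroMode` is decidable. [ours; bookkeeping] -/
instance instDecidableNoZeroMode (p : TP) : Decidable (NoZeroMode p) := by
  unfold NoZeroMode; infer_instance

/-- `|k|² ≠ 0` for `k ≠ 0`. [ours; bookkeeping] -/
theorem Mode.normSq_ne_zero {k : Mode} (hk : k ≠ 0) : k.normSq ≠ 0 := by
  obtain ⟨a, b, c⟩ := k
  intro h
  simp only [Mode.normSq] at h
  have ha : (a : ℚ) = 0 := by nlinarith [sq_nonneg (a : ℚ), sq_nonneg (b : ℚ), sq_nonneg (c : ℚ)]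
  have hb : (b : ℚ) = 0 := by nlinarith [sq_nonneg (a : ℚ), sq_nonneg (b : ℚ), sq_nonneg (c : ℚ)]
  have hc : (c : ℚ) = 0 := by nlinarith [sq_nonneg (a : ℚ), sq_nonneg (b : ℚ), sq_nonneg (c : ℚ)]
  exact hk (by simp [Int.cast_eq_zero.mp ha, Int.cast_eq_zero.mp hb, Int.cast_eq_zero.mp hc])

/-- `lapT (linv p)` denotes the same function as `p` when `p` has no zero mode. [ours; bookkeeping] -/
theorem eval_lapT_linv {p : TP} (hp : NoZeroMode p) (x : UnitAddTorus (Fin 3)) :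
    eval (lapT (linv p)) x = eval p x := by
  induction p with
  | nil => simp [lapT, linv, D]
  | cons t p ih =>
    have hp' : NoZeroMode p := fun s hs => hp s (List.mem_cons_of_mem _ hs)
    have ht : t.1 ≠ 0 := hp t (List.mem_cons_self ..)
    have hn : (t.1.normSq : ℂ) ≠ 0 := by exact_mod_cast Mode.normSq_ne_zero ht
    have ih' := ih hp'
    simp only [lapT, linv, D, List.map_cons, List.map_map, eval_append, eval_cons, List.cons_append,
      GQ.toC_smul, GQ.toC_mul, GQ.toC_I] at ih' ⊢
    have key : (t.1.normSq : ℂ) = (t.1.vec 0 : ℂ) ^ 2 + (t.1.vec 1 : ℂ) ^ 2 + (t.1.vec 2 : ℂ) ^ 2 := by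
      simp [Mode.normSq]
    rw [← ih']
    push_cast
    -- the scalar identity `∑ⱼ kⱼ·i·kⱼ·i·(−1/|k|²)·c = c`
    have hscal : ∀ z : ℂ,
        (t.1.vec 0 : ℂ) * (Complex.I * ((t.1.vec 0 : ℂ) * (Complex.I * (-(1 / (t.1.normSq : ℂ)) * z)))) +
        (t.1.vec 1 : ℂ) * (Complex.I * ((t.1.vec 1 : ℂ) * (Complex.I * (-(1 / (t.1.normSq : ℂ)) * z)))) +
        (t.1.vec 2 : ℂ) * (Complex.I * ((t.1.vec 2 : ℂ) * (Complex.I * (-(1 / (t.1.normSq : ℂ)) * z)))) = z := by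
      intro z
      have e1 : (t.1.vec 0 : ℂ) * (Complex.I * ((t.1.vec 0 : ℂ) * (Complex.I * (-(1 / (t.1.normSq : ℂ)) * z)))) +
        (t.1.vec 1 : ℂ) * (Complex.I * ((t.1.vec 1 : ℂ) * (Complex.I * (-(1 / (t.1.normSq : ℂ)) * z)))) +
        (t.1.vec 2 : ℂ) * (Complex.I * ((t.1.vec 2 : ℂ) * (Complex.I * (-(1 / (t.1.normSq : ℂ)) * z)))) =
          -(Complex.I * Complex.I) * (((t.1.vec 0 : ℂ)) ^ 2 + ((t.1.vec 1 : ℂ)) ^ 2 +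
            ((t.1.vec 2 : ℂ)) ^ 2) * (1 / (t.1.normSq : ℂ)) * z := by ring
      rw [e1, Complex.I_mul_I, ← key]
      field_simp
    linear_combination (hscal (t.2.toC * mFourier t.1.vec x))

/-- `linv p` has no zero-mode mass: `coeff0 (linv p) = 0` when `p` has no zero mode. [ours; bookkeeping] -/
theorem coeff0_linv {p : TP} (hp : NoZeroMode p) : coeff0 (linv p) = GQ.zero := by
  induction p with
  | nil => rfl
  | cons t p ih =>
    have hp' : NoZeroMode p := fun s hs => hp s (List.mem_cons_of_mem _ hs)
    have ht : t.1 ≠ 0 := hp t (List.mem_cons_self ..)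
    simp [linv, coeff0, ht, ← ih hp']

/-- `linv` preserves reality (no zero mode). [ours; bookkeeping] -/
theorem IsReal.linv {p : TP} (hp : IsReal p) (hz : NoZeroMode p) : IsReal (TP.linv p) := by
  -- `Im (eval (linv p))` is a trigonometric polynomial with `Δ = (2π)² Im (eval p) = 0` and mean `0`
  -- (no zero mode); by the tree's uniqueness `Δ⁻¹Δh = h` it vanishes identically.
  intro x
  -- Im (eval (TP.linv p)) is a trigonometric polynomial whose Laplacian is Im((2π)² eval p) = 0 and whose
  -- mean is 0; hence it vanishes. We implement this with the tree's uniqueness lemma.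
  have hsm : IsSmooth (fun y => (eval (TP.linv p) y).im) := IsSmooth.comp_clm Complex.imCLM (isSmooth_eval _)
  have hlap : Torus.laplacian (fun y => (eval (TP.linv p) y).im) = fun _ => 0 := by
    funext y
    have h1 : (fun y => (eval (TP.linv p) y).im) = Complex.imCLM ∘ eval (TP.linv p) := rfl
    rw [laplacian_eq_sum_partialDeriv_partialDeriv hsm]
    have hD : ∀ j : Fin 3, Torus.partialDeriv j (Torus.partialDeriv j (fun y => (eval (TP.linv p) y).im)) y =
        (2 * Real.pi) ^ 2 * (eval (TP.D j (TP.D j (TP.linv p))) y).im := by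
      intro j
      have e1 : Torus.partialDeriv j (fun y => (eval (TP.linv p) y).im) =
          fun y => 2 * Real.pi * (eval (TP.D j (TP.linv p)) y).im := by
        funext z
        rw [h1, partialDeriv_clm_comp (isSmooth_eval _), partialDeriv_eval]
        simp [Complex.mul_im]
      rw [e1]
      have e2 : (fun y => 2 * Real.pi * (eval (TP.D j (TP.linv p)) y).im) =
          (2 * Real.pi) • (Complex.imCLM ∘ eval (TP.D j (TP.linv p))) := by funext z; simp
      rw [e2, partialDeriv_const_smul ((IsSmooth.comp_clm Complex.imCLM (isSmooth_eval _)).isContDiff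
        (by simp)), Pi.smul_apply, partialDeriv_clm_comp (isSmooth_eval _), partialDeriv_eval]
      simp only [smul_eq_mul, Complex.imCLM_apply, Complex.mul_im, Complex.re_ofNat, Complex.im_ofNat,
        Complex.ofReal_re, Complex.ofReal_im, Complex.mul_re]
      ring
    rw [Fin.sum_univ_three, hD, hD, hD]
    have hsum : (eval (TP.D 0 (TP.D 0 (TP.linv p))) y).im + (eval (TP.D 1 (TP.D 1 (TP.linv p))) y).im +
        (eval (TP.D 2 (TP.D 2 (TP.linv p))) y).im = (eval (TP.lapT (TP.linv p)) y).im := by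
      simp only [TP.lapT, eval_append, Complex.add_im]
    have hreal : (eval (TP.lapT (TP.linv p)) y).im = 0 := by rw [eval_lapT_linv hz]; exact hp y
    linear_combination ((2 * Real.pi) ^ 2 : ℝ) * (hsum.trans hreal)
  have hmean : ∫ y, (eval (TP.linv p) y).im = 0 := by
    have hi : Integrable (eval (TP.linv p)) := (isSmooth_eval _).continuous.integrable_unitAddTorus
    have him := integral_im hi
    simp only [RCLike.im_to_complex] at him
    rw [him, integral_eval, coeff0_linv hz]; simp [GQ.zero, GQ.toC]
  have key := invLaplacian_laplacian_of_integral_eq_zero hsm hmean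
  rw [hlap] at key
  have h0 : Torus.invLaplacian (fun _ : UnitAddTorus (Fin 3) => (0 : ℝ)) = 0 := invLaplacian_zero
  rw [h0] at key
  exact (congrFun key x).symm

/-- **`Δ⁻¹ evalR p = (2π)⁻² · evalR (linv p)`** for real tables without zero mode. [ours; bookkeeping] -/
theorem invLaplacian_evalR {p : TP} (hz : NoZeroMode p) :
    Torus.invLaplacian (evalR p) = fun x => ((2 * Real.pi) ^ 2)⁻¹ * evalR (linv p) x := by
  set g : UnitAddTorus (Fin 3) → ℝ := fun x => ((2 * Real.pi) ^ 2)⁻¹ * evalR (linv p) x with hg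
  have hgs : IsSmooth g := by
    have : g = ((2 * Real.pi) ^ 2)⁻¹ • evalR (linv p) := by funext y; simp [hg]
    rw [this]; exact (isSmooth_evalR _).smul _
  have hlap : Torus.laplacian g = evalR p := by
    funext y
    have : g = ((2 * Real.pi) ^ 2)⁻¹ • evalR (linv p) := by funext z; simp [hg]
    rw [this, laplacian_const_smul_apply (isSmooth_evalR _), smul_eq_mul, laplacian_evalR]
    have hpi : ((2 * Real.pi) ^ 2 : ℝ) ≠ 0 := by positivity
    field_simp
    simp only [evalR]
    rw [eval_lapT_linv hz]
  have hmean : ∫ y, g y = 0 := by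
    simp only [hg, integral_const_mul, integral_evalR, coeff0_linv hz]
    simp [GQ.zero]
  have key := invLaplacian_laplacian_of_integral_eq_zero hgs hmean
  rw [hlap] at key
  exact key

/-! ## 5. Real input pairs -/

/-- The real pair `c e_k + c̄ e_{−k}` (`= 2 Re (c e_k)`). [ours; bookkeeping] -/
def symm (k : Mode) (c : GQ) : TP := [(k, c), (-k, c.conj)]

/-- `symm k c` is real. [ours; bookkeeping] -/
theorem isReal_symm (k : Mode) (c : GQ) : IsReal (symm k c) := by
  intro x
  simp only [symm, eval_cons, eval_nil, add_zero, GQ.toC_conj, Mode.vec_neg, mFourier_neg]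
  rw [← map_mul, Complex.add_im, Complex.conj_im]
  ring

/-- `IsReal []`. [ours; bookkeeping] -/
theorem isReal_nil : IsReal ([] : TP) := fun x => by simp

end TP

end TrigPolyExact

end Summit.NavierStokesRegularity.FunctionalMining

end
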